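import Literature.Geometry.Lorentzian.MetricNormSq
import Literature.Geometry.Lorentzian.InitialData
import HarnessLib

/-!
# The metric square norm `|T|²_g` of a trilinear form; `|∇k|²_h` of an initial data set

For a `C^n` pseudo-Riemannian metric `g` on a vector bundle `E → B` with finite-dimensional model
fibre, this file adds to the pointwise metric contractions of `PseudoRiemannianMetric.lean`
(`trace`, `normSq`) and `MetricNormSq.lean` (frame formula, positivity):

* `PseudoRiemannianMetric.innerBilin g b S S'` — the **metric pairing of two bilinear forms**
  `⟨S, S'⟩_g = g^{ik} g^{jl} S_{ij} S'_{kl}`, the polarisation of `normSq`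
  (`innerBilin g b T T = normSq g b T` by `rfl`), defined like `normSq` as the trace of
  `(♯ ∘ S) ∘ (♯ ∘ S'ᵗ)`; frame formula `innerBilin_eq_sum_mul`, bilinearity (`innerBilinForm`),
  symmetry (`innerBilin_comm`);
* `PseudoRiemannianMetric.normSq₃ g b T` — the **metric square norm of a trilinear form**
  `T : E b →ₗ E b →ₗ E b →ₗ ℝ`, `|T|²_g = g^{ii'} g^{jj'} g^{ll'} T_{ijl} T_{i'j'l'}`, defined
  WITHOUT choosing a frame as the iterated contraction `tr_g [(X, X') ↦ ⟨T(X,·,·), T(X',·,·)⟩_g]`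
  (compare `curvNormSqWith`, `Literature/Geometry/Riemannian/CurvatureNormSq.lean`, which
  contracts the curvature tensor the same way);
* `PseudoRiemannianMetric.normSq₃_eq_sum_sq` — the **frame formula**: in a `g_b`-orthogonal basis
  `e` of non-null vectors, `|T|²_g = ∑ᵢ ∑ⱼ ∑ₗ T(eᵢ,eⱼ,eₗ)² / (g(eᵢ,eᵢ) g(eⱼ,eⱼ) g(eₗ,eₗ))`
  (`= ∑ T(eᵢ,eⱼ,eₗ)²` in an orthonormal frame of a Riemannian metric) — the index formula with
  `g^{ii} = 1/g(eᵢ,eᵢ)`; `normSq₃_nonneg`, `normSq₃_pos`, `normSq₃_eq_zero_iff` — for a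
  **Riemannian** metric `|T|²_g ≥ 0` with equality iff `T = 0` (no sign for indefinite `g`);
* `trilinForm T` — a continuous trilinear form `V →L V →L V →L ℝ` (the type of the covariant
  differential `g.covDeriv₂ k x`, `LeviCivita.lean`) with continuity forgotten, so that `normSq₃`
  applies (rank-`3` analogue of `ContinuousLinearMap.toLinearMap₁₂` behind `InitialDataSet.kBilin`);
* `InitialDataSet.normSqCovDerivK D x = |∇k|²_h (x)` — for an initial data set `D = (h, k)`, the
  square norm w.r.t. `h` of the covariant derivative `∇k = D.metric.covDeriv₂ D.k` of the second
  fundamental form (slot convention `(∇k)(X, Y, Z) = (∇_Z k)(X, Y)`; the full contraction is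
  insensitive to the order of the slots): the density of `‖∇k‖²_{L²(Σ₀)} = ∫_{Σ₀} |∇k|²_h dV_h` in
  the hypotheses of the bounded `L²` curvature theorem (Klainerman–Rodnianski–Szeftel 2015,
  Thm. 2.2: `Ric ∈ L²(Σ₀)`, `∇k ∈ L²(Σ₀)`, `r_vol(Σ₀, 1) > 0`; versions Thm. 2.6, 2.10) and of the
  estimate `∫_{Σ₀} |∇k|² + ¼ |k|⁴ ≤ ∫_{Σ₀} |𝐑|²` on maximal vacuum slices (ibid., Remark 2.4);
  the `L²`-norm over a set `B` is `∫ x in B, D.normSqCovDerivK x ∂(riemannianMeasure D.h)`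
  (`Volume.lean`). Nonnegativity, frame formula, vanishing iff `(∇k)_x = 0` and for
  time-symmetric data.

What is NOT here: smoothness / measurability of `x ↦ |∇k|²_h(x)` (which needs the regularity of
`x ↦ (∇k)_x`; compare `RicciNormSq.lean` for `|Ric|²`), and any integrated (`L²`) object — users
integrate the density against `riemannianMeasure D.h` over the set they need.

## References

* B. O'Neill, *Semi-Riemannian geometry with applications to relativity*, Academic Press 1983,
  Ch. 3, pp. 60–61 (metric contraction of tensors in a frame; musical isomorphisms).
* S. Klainerman, I. Rodnianski, J. Szeftel, *The bounded `L²` curvature conjecture*, Invent.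
  Math. 202 (2015), 91–216 (arXiv:1204.1767), §2.2, Thm. 2.2 and Remark 2.4 (`‖∇k‖_{L²(Σ₀)}`).
-/

noncomputable section

open Manifold Bundle Module
open scoped ContDiff

namespace Literature.Geometry.Lorentzian

/-! ### Linear algebra: the polarised frame formula -/

section Algebra

variable {V : Type*} [AddCommGroup V] [Module ℝ V]

/-- **Trace of the product of the index-raisings of two bilinear forms, in an orthogonal basis**
(polarisation of `trace_comp_eq_sum_sq`). Let `q` be a bilinear form on `V` with a `q`-orthogonal
basis `b` of non-null vectors, `S, S'` bilinear forms, and `A, B` endomorphisms with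
`q(A v, w) = S(v, w)` and `q(B v, w) = S'(w, v)` (index raising of `S` and of the transpose of
`S'`). Then `tr (A ∘ B) = ∑ᵢ ∑ⱼ S(bⱼ, bᵢ) S'(bⱼ, bᵢ) / (q(bᵢ,bᵢ) q(bⱼ,bⱼ))` — the frame formula
`S_{ij} S'^{ij} = ∑ S_{ji} S'_{ji} / (qᵢ qⱼ)` (O'Neill 1983, Ch. 3, pp. 60–61, metric contraction in
a frame). [folklore] -/
theorem trace_comp_eq_sum_mul {ι : Type*} [Fintype ι] [DecidableEq ι] (b : Basis ι ℝ V)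
    {q : LinearMap.BilinForm ℝ V} (hb : q.IsOrthoᵢ b) (hc : ∀ i, q (b i) (b i) ≠ 0)
    (S S' : LinearMap.BilinForm ℝ V) (A B : V →ₗ[ℝ] V)
    (hA : ∀ v w, q (A v) w = S v w) (hB : ∀ v w, q (B v) w = S' w v) :
    LinearMap.trace ℝ V (A ∘ₗ B) =
      ∑ i, ∑ j, S (b j) (b i) * S' (b j) (b i) / (q (b i) (b i) * q (b j) (b j)) := by
  classical
  have hcoord := repr_eq_div_of_isOrthoᵢ b hb hc
  rw [LinearMap.trace_eq_matrix_trace ℝ b, Matrix.trace]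
  refine Finset.sum_congr rfl fun i _ ↦ ?_
  rw [Matrix.diag_apply, LinearMap.toMatrix_apply, hcoord, LinearMap.comp_apply]
  have hBi : B (b i) = ∑ j, (S' (b j) (b i) / q (b j) (b j)) • b j := by
    conv_lhs => rw [← b.sum_repr (B (b i))]
    refine Finset.sum_congr rfl fun j _ ↦ ?_
    rw [hcoord, hB]
  rw [hBi, map_sum, map_sum, LinearMap.sum_apply, Finset.sum_div]
  refine Finset.sum_congr rfl fun j _ ↦ ?_
  rw [map_smul, map_smul, LinearMap.smul_apply, smul_eq_mul, hA]
  field_simp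

end Algebra

/-! ### Continuous trilinear forms as trilinear maps -/

section Trilin

variable {V : Type*} [TopologicalSpace V] [AddCommGroup V] [Module ℝ V]

/-- A continuous trilinear form `T : V →L V →L V →L ℝ` on a topological vector space (e.g. the
covariant differential `(∇k)_x = g.covDeriv₂ k x` of a field of bilinear forms, `LeviCivita.lean`)
as an algebraic trilinear map `V →ₗ V →ₗ V →ₗ ℝ`, forgetting continuity: the rank-`3` analogue of
Mathlib's `ContinuousLinearMap.toLinearMap₁₂`. [folklore] -/
def trilinForm (T : V →L[ℝ] V →L[ℝ] V →L[ℝ] ℝ) : V →ₗ[ℝ] V →ₗ[ℝ] V →ₗ[ℝ] ℝ :=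
  T.toLinearMap₁₂.compr₂ (ContinuousLinearMap.coeLM ℝ)

/-- `trilinForm` does not change values. [folklore] -/
@[simp]
theorem trilinForm_apply (T : V →L[ℝ] V →L[ℝ] V →L[ℝ] ℝ) (X Y Z : V) :
    trilinForm T X Y Z = T X Y Z := rfl

/-- `trilinForm 0 = 0`. [folklore] -/
@[simp]
theorem trilinForm_zero : trilinForm (0 : V →L[ℝ] V →L[ℝ] V →L[ℝ] ℝ) = 0 := rfl

/-- Forgetting continuity is injective: `trilinForm T = 0 ↔ T = 0`. [folklore] -/
@[simp]
theorem trilinForm_eq_zero_iff (T : V →L[ℝ] V →L[ℝ] V →L[ℝ] ℝ) : trilinForm T = 0 ↔ T = 0 := by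
  refine ⟨fun h ↦ ?_, fun h ↦ by rw [h, trilinForm_zero]⟩
  ext X Y Z
  simpa using congrArg (fun T' ↦ T' X Y Z) h

end Trilin

namespace PseudoRiemannianMetric

section Fibre

variable
  {EB : Type*} [NormedAddCommGroup EB] [NormedSpace ℝ EB]
  {HB : Type*} [TopologicalSpace HB] {IB : ModelWithCorners ℝ EB HB} {n : ℕ∞ω}
  {B : Type*} [TopologicalSpace B] [ChartedSpace HB B]
  {F : Type*} [NormedAddCommGroup F] [NormedSpace ℝ F] [FiniteDimensional ℝ F]
  {E : B → Type*} [TopologicalSpace (TotalSpace F E)]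
  [∀ b, TopologicalSpace (E b)] [∀ b, AddCommGroup (E b)] [∀ b, Module ℝ (E b)]
  [FiberBundle F E] [VectorBundle ℝ F E]
  (g : PseudoRiemannianMetric IB n F E) (b : B)

/-! ### The metric pairing of bilinear forms -/

/-- **Metric pairing of two bilinear forms** on the fibre at `b`:
`⟨S, S'⟩_g = S_{ij} S'^{ij} = g^{ik} g^{jl} S_{ij} S'_{kl}`, defined as the trace of
`(♯ ∘ S) ∘ (♯ ∘ S'ᵗ)` (`S'ᵗ = S'.flip`) — the polarisation of the metric square norm `normSq`
(`innerBilin g b T T = normSq g b T`, `innerBilin_self`). O'Neill 1983, Ch. 3, pp. 60–61 (metric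
contraction). [folklore] -/
def innerBilin (S S' : LinearMap.BilinForm ℝ (E b)) : ℝ :=
  LinearMap.trace ℝ (E b)
    (((g.sharp b).toLinearMap ∘ₗ S) ∘ₗ ((g.sharp b).toLinearMap ∘ₗ S'.flip))

/-- The metric pairing of a bilinear form with itself is its metric square norm (by definition).
[folklore] -/
@[simp]
theorem innerBilin_self (T : LinearMap.BilinForm ℝ (E b)) : g.innerBilin b T T = g.normSq b T :=
  rfl

/-- **Frame formula for the metric pairing**: in a `g_b`-orthogonal basis `e` of non-null vectors,
`⟨S, S'⟩_g = ∑ᵢ ∑ⱼ S(eⱼ,eᵢ) S'(eⱼ,eᵢ) / (g(eᵢ,eᵢ) g(eⱼ,eⱼ))` (`trace_comp_eq_sum_mul` with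
`A = ♯ ∘ S`, `B = ♯ ∘ S'ᵗ`, `val_sharp_apply`). O'Neill 1983, Ch. 3, pp. 60–61. [folklore] -/
theorem innerBilin_eq_sum_mul {ι : Type*} [Fintype ι] [DecidableEq ι] (e : Basis ι ℝ (E b))
    (he : (g.toBilinForm b).IsOrthoᵢ e) (hc : ∀ i, g.val b (e i) (e i) ≠ 0)
    (S S' : LinearMap.BilinForm ℝ (E b)) :
    g.innerBilin b S S' =
      ∑ i, ∑ j, S (e j) (e i) * S' (e j) (e i) / (g.val b (e i) (e i) * g.val b (e j) (e j)) := by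
  have hA : ∀ v w, g.toBilinForm b (((g.sharp b).toLinearMap ∘ₗ S) v) w = S v w := by
    intro v w
    simp
  have hB : ∀ v w, g.toBilinForm b (((g.sharp b).toLinearMap ∘ₗ S'.flip) v) w = S' w v := by
    intro v w
    simp
  exact trace_comp_eq_sum_mul e he hc S S' _ _ hA hB

/-- The metric pairing is additive in the first form. [folklore] -/
theorem innerBilin_add_left (S₁ S₂ S' : LinearMap.BilinForm ℝ (E b)) :
    g.innerBilin b (S₁ + S₂) S' = g.innerBilin b S₁ S' + g.innerBilin b S₂ S' := by
  simp only [innerBilin, LinearMap.comp_add, LinearMap.add_comp, map_add]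

/-- The metric pairing is homogeneous in the first form. [folklore] -/
theorem innerBilin_smul_left (c : ℝ) (S S' : LinearMap.BilinForm ℝ (E b)) :
    g.innerBilin b (c • S) S' = c * g.innerBilin b S S' := by
  simp only [innerBilin, LinearMap.comp_smul, LinearMap.smul_comp, map_smul, smul_eq_mul]

/-- The metric pairing is additive in the second form. [folklore] -/
theorem innerBilin_add_right (S S₁ S₂ : LinearMap.BilinForm ℝ (E b)) :
    g.innerBilin b S (S₁ + S₂) = g.innerBilin b S S₁ + g.innerBilin b S S₂ := by
  have h : (S₁ + S₂).flip = S₁.flip + S₂.flip := rfl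
  simp only [innerBilin, h, LinearMap.comp_add, map_add]

/-- The metric pairing is homogeneous in the second form. [folklore] -/
theorem innerBilin_smul_right (c : ℝ) (S S' : LinearMap.BilinForm ℝ (E b)) :
    g.innerBilin b S (c • S') = c * g.innerBilin b S S' := by
  have h : (c • S').flip = c • S'.flip := rfl
  simp only [innerBilin, h, LinearMap.comp_smul, map_smul, smul_eq_mul]

/-- The metric pairing with the zero form vanishes. [folklore] -/
@[simp]
theorem innerBilin_zero_left (S' : LinearMap.BilinForm ℝ (E b)) : g.innerBilin b 0 S' = 0 := by
  simp [innerBilin]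

/-- The metric pairing is symmetric, `⟨S, S'⟩_g = ⟨S', S⟩_g` (read off from the frame formula in a
`g_b`-orthogonal basis, `exists_isOrthoᵢ_basis`). O'Neill 1983, Ch. 3, pp. 60–61. [folklore] -/
theorem innerBilin_comm (S S' : LinearMap.BilinForm ℝ (E b)) :
    g.innerBilin b S S' = g.innerBilin b S' S := by
  classical
  obtain ⟨e, he, hc⟩ := g.exists_isOrthoᵢ_basis b
  rw [g.innerBilin_eq_sum_mul b e he hc, g.innerBilin_eq_sum_mul b e he hc]
  refine Finset.sum_congr rfl fun i _ ↦ Finset.sum_congr rfl fun j _ ↦ ?_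
  rw [mul_comm (S (e j) (e i))]

/-- The metric pairing with the zero form vanishes. [folklore] -/
@[simp]
theorem innerBilin_zero_right (S : LinearMap.BilinForm ℝ (E b)) : g.innerBilin b S 0 = 0 := by
  rw [innerBilin_comm, innerBilin_zero_left]

/-- The metric pairing `⟨·, ·⟩_g` as a bilinear form on the space of bilinear forms of the fibre.
[folklore] -/
def innerBilinForm : LinearMap.BilinForm ℝ (LinearMap.BilinForm ℝ (E b)) :=
  LinearMap.mk₂ ℝ (g.innerBilin b) (g.innerBilin_add_left b) (g.innerBilin_smul_left b)
    (g.innerBilin_add_right b) (g.innerBilin_smul_right b)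

/-- Unfolding lemma for `innerBilinForm`. [folklore] -/
@[simp]
theorem innerBilinForm_apply (S S' : LinearMap.BilinForm ℝ (E b)) :
    g.innerBilinForm b S S' = g.innerBilin b S S' := rfl

/-! ### The metric square norm of a trilinear form -/

/-- **Metric square norm of a trilinear form** `T` on the fibre at `b`:
`|T|²_g = T_{ijl} T^{ijl} = g^{ii'} g^{jj'} g^{ll'} T_{ijl} T_{i'j'l'}`, defined frame-free as the
iterated metric contraction `tr_g [(X, X') ↦ ⟨T(X,·,·), T(X',·,·)⟩_g]`: the metric trace
(`PseudoRiemannianMetric.trace`) of the bilinear form pairing the rank-`2` slices of `T` by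
`innerBilin`. In a `g_b`-orthogonal frame it is `∑ T(eᵢ,eⱼ,eₗ)² / (gᵢ gⱼ gₗ)`
(`normSq₃_eq_sum_sq`); not necessarily nonnegative for an indefinite metric, `≥ 0` for a
Riemannian one (`normSq₃_nonneg`). O'Neill 1983, Ch. 3, pp. 60–61 (metric contraction).
[folklore] -/
def normSq₃ (T : E b →ₗ[ℝ] E b →ₗ[ℝ] E b →ₗ[ℝ] ℝ) : ℝ :=
  g.trace b ((g.innerBilinForm b).compl₁₂ T T)

/-- The metric trace in a `g_b`-orthogonal frame of non-null vectors:
`tr_g Q = ∑ᵢ Q(eᵢ, eᵢ) / g(eᵢ, eᵢ)` (local copy of the frame formula of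
`RicciFlowScalarCurvatureComparison.lean` / `SecondFundamentalFormNormSq.lean`, kept private to
avoid importing the Ricci-flow files). [folklore] -/
private theorem trace_eq_sum_div₃ {ι : Type*} [Fintype ι] [DecidableEq ι]
    (e : Basis ι ℝ (E b)) (he : (g.toBilinForm b).IsOrthoᵢ e)
    (hc : ∀ i, g.val b (e i) (e i) ≠ 0) (Q : LinearMap.BilinForm ℝ (E b)) :
    g.trace b Q = ∑ i, Q (e i) (e i) / g.val b (e i) (e i) := by
  classical
  rw [PseudoRiemannianMetric.trace, LinearMap.trace_eq_matrix_trace ℝ e, Matrix.trace]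
  refine Finset.sum_congr rfl fun i _ ↦ ?_
  rw [Matrix.diag_apply, LinearMap.toMatrix_apply, repr_eq_div_of_isOrthoᵢ e he hc,
    LinearMap.comp_apply]
  simp

/-- **Frame formula for the metric square norm of a trilinear form**: in a `g_b`-orthogonal basis
`e` of non-null vectors,
`|T|²_g = ∑ᵢ ∑ⱼ ∑ₗ T(eᵢ, eⱼ, eₗ)² / (g(eᵢ,eᵢ) g(eⱼ,eⱼ) g(eₗ,eₗ))` — the index formula
`g^{ii'} g^{jj'} g^{ll'} T_{ijl} T_{i'j'l'}` with `g^{ii} = 1/g(eᵢ,eᵢ)` in an orthogonal frame (in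
particular `∑ T(eᵢ,eⱼ,eₗ)²` in an orthonormal frame of a Riemannian metric).
O'Neill 1983, Ch. 3, pp. 60–61. [folklore] -/
theorem normSq₃_eq_sum_sq {ι : Type*} [Fintype ι] [DecidableEq ι] (e : Basis ι ℝ (E b))
    (he : (g.toBilinForm b).IsOrthoᵢ e) (hc : ∀ i, g.val b (e i) (e i) ≠ 0)
    (T : E b →ₗ[ℝ] E b →ₗ[ℝ] E b →ₗ[ℝ] ℝ) :
    g.normSq₃ b T = ∑ i, ∑ j, ∑ l, T (e i) (e j) (e l) ^ 2 /
      (g.val b (e i) (e i) * g.val b (e j) (e j) * g.val b (e l) (e l)) := by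
  rw [normSq₃, g.trace_eq_sum_div₃ b e he hc]
  refine Finset.sum_congr rfl fun i _ ↦ ?_
  rw [LinearMap.compl₁₂_apply, innerBilinForm_apply, g.innerBilin_eq_sum_mul b e he hc,
    Finset.sum_comm, Finset.sum_div]
  refine Finset.sum_congr rfl fun j _ ↦ ?_
  rw [Finset.sum_div]
  refine Finset.sum_congr rfl fun l _ ↦ ?_
  have hi := hc i
  have hj := hc j
  have hl := hc l
  field_simp

/-- The square norm of the zero trilinear form vanishes (any signature). [folklore] -/
@[simp]
theorem normSq₃_zero : g.normSq₃ b 0 = 0 := by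
  have h : (g.innerBilinForm b).compl₁₂ (0 : E b →ₗ[ℝ] E b →ₗ[ℝ] E b →ₗ[ℝ] ℝ)
      (0 : E b →ₗ[ℝ] E b →ₗ[ℝ] E b →ₗ[ℝ] ℝ) = 0 :=
    LinearMap.ext₂ fun X X' ↦ by simp
  simp [normSq₃, PseudoRiemannianMetric.trace, h]

/-- For a **Riemannian** metric the square norm of a trilinear form on a fibre is nonnegative, and
positive unless the form vanishes: in a `g_b`-orthogonal basis it is the sum of squares
`normSq₃_eq_sum_sq` with `g(eᵢ,eᵢ) > 0`. O'Neill 1983, Ch. 3, pp. 60–61. [folklore] -/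
theorem normSq₃_nonneg_and_pos (hg : g.IsRiemannian) (T : E b →ₗ[ℝ] E b →ₗ[ℝ] E b →ₗ[ℝ] ℝ) :
    0 ≤ g.normSq₃ b T ∧ (T ≠ 0 → 0 < g.normSq₃ b T) := by
  classical
  obtain ⟨e, he, -⟩ := g.exists_isOrthoᵢ_basis b
  have hpos : ∀ i, 0 < g.val b (e i) (e i) := fun i ↦ hg b (e i) (e.ne_zero i)
  have hn := g.normSq₃_eq_sum_sq b e he (fun i ↦ (hpos i).ne') T
  have hterm : ∀ i j l, 0 ≤ T (e i) (e j) (e l) ^ 2 /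
      (g.val b (e i) (e i) * g.val b (e j) (e j) * g.val b (e l) (e l)) :=
    fun i j l ↦ div_nonneg (sq_nonneg _) (mul_pos (mul_pos (hpos i) (hpos j)) (hpos l)).le
  refine ⟨hn ▸ Finset.sum_nonneg fun i _ ↦ Finset.sum_nonneg fun j _ ↦
    Finset.sum_nonneg fun l _ ↦ hterm i j l, fun hT ↦ ?_⟩
  obtain ⟨i, j, l, hijl⟩ : ∃ i j l, T (e i) (e j) (e l) ≠ 0 := by
    by_contra hall
    push Not at hall
    exact hT (e.ext fun i ↦ e.ext fun j ↦ e.ext fun l ↦ by simpa using hall i j l)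
  rw [hn]
  refine lt_of_lt_of_le ?_ (Finset.single_le_sum (fun i _ ↦ Finset.sum_nonneg fun j _ ↦
    Finset.sum_nonneg fun l _ ↦ hterm i j l) (Finset.mem_univ i))
  refine lt_of_lt_of_le ?_ (Finset.single_le_sum (fun j _ ↦ Finset.sum_nonneg fun l _ ↦
    hterm i j l) (Finset.mem_univ j))
  refine lt_of_lt_of_le ?_ (Finset.single_le_sum (fun l _ ↦ hterm i j l) (Finset.mem_univ l))
  exact div_pos (by positivity) (mul_pos (mul_pos (hpos i) (hpos j)) (hpos l))

/-- For a Riemannian metric, `|T|²_g ≥ 0` for every trilinear form `T` on a fibre.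
O'Neill 1983, Ch. 3, pp. 60–61. [folklore] -/
theorem normSq₃_nonneg (hg : g.IsRiemannian) (T : E b →ₗ[ℝ] E b →ₗ[ℝ] E b →ₗ[ℝ] ℝ) :
    0 ≤ g.normSq₃ b T :=
  (g.normSq₃_nonneg_and_pos b hg T).1

/-- For a Riemannian metric, `|T|²_g > 0` for every nonzero trilinear form `T` on a fibre.
O'Neill 1983, Ch. 3, pp. 60–61. [folklore] -/
theorem normSq₃_pos (hg : g.IsRiemannian) {T : E b →ₗ[ℝ] E b →ₗ[ℝ] E b →ₗ[ℝ] ℝ} (hT : T ≠ 0) :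
    0 < g.normSq₃ b T :=
  (g.normSq₃_nonneg_and_pos b hg T).2 hT

/-- For a Riemannian metric, `|T|²_g = 0` iff `T = 0`. O'Neill 1983, Ch. 3, pp. 60–61.
[folklore] -/
theorem normSq₃_eq_zero_iff (hg : g.IsRiemannian) (T : E b →ₗ[ℝ] E b →ₗ[ℝ] E b →ₗ[ℝ] ℝ) :
    g.normSq₃ b T = 0 ↔ T = 0 := by
  refine ⟨fun h ↦ ?_, fun h ↦ by rw [h, normSq₃_zero]⟩
  by_contra hT
  exact (g.normSq₃_pos b hg hT).ne' h

end Fibre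

end PseudoRiemannianMetric

/-! ### `|∇k|²_h` for an initial data set -/

namespace InitialDataSet

variable {E : Type*} [NormedAddCommGroup E] [NormedSpace ℝ E] {H : Type*} [TopologicalSpace H]
  {I : ModelWithCorners ℝ E H} {X : Type*} [TopologicalSpace X] [ChartedSpace H X]
  [IsManifold I ∞ X] [FiniteDimensional ℝ E]

/-- **`|∇k|²_h (x)`, the square norm of the covariant derivative of the second fundamental form**
of the initial data set `D = (h, k)` at `x`:
`|∇k|²_h = h^{ii'} h^{jj'} h^{ll'} (∇k)_{ijl} (∇k)_{i'j'l'}`, the metric square norm `normSq₃` with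
respect to `h` of the trilinear form `(∇k)_x = D.metric.covDeriv₂ D.k x`
(`(∇k)_x(X, Y, Z) = (∇_Z k)(X, Y)`, `LeviCivita.lean`; the full contraction does not depend on
the order of the slots). It is the density of `‖∇k‖²_{L²(Σ₀)} = ∫_{Σ₀} |∇k|²_h dV_h` in the
hypotheses `Ric ∈ L²(Σ₀)`, `∇k ∈ L²(Σ₀)`, `r_vol(Σ₀,1) > 0` of the bounded `L²` curvature theorem
and in the estimate `∫_{Σ₀} |∇k|² + ¼|k|⁴ ≤ ∫_{Σ₀} |𝐑|²` on maximal vacuum slices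
(Klainerman–Rodnianski–Szeftel 2015, §2.2, Thm. 2.2 and Remark 2.4); the `L²`-norm over a set
`B ⊆ X` is `∫ x in B, D.normSqCovDerivK x ∂(riemannianMeasure D.h)` (`Volume.lean`). Standing
hypothesis `[D.metric.HasLeviCivita]` as for every notion built on the Levi-Civita connection of
`h` (`InitialData.lean`). [cite: KlainermanRodnianskiSzeftel2015, §2.2 Thm. 2.2 and Remark 2.4] -/
def normSqCovDerivK (D : InitialDataSet I X) [D.metric.HasLeviCivita] (x : X) : ℝ :=
  D.metric.normSq₃ x (trilinForm (D.metric.covDeriv₂ D.k x))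

/-- Unfolding lemma for `normSqCovDerivK`. [folklore] -/
theorem normSqCovDerivK_def (D : InitialDataSet I X) [D.metric.HasLeviCivita] (x : X) :
    D.normSqCovDerivK x = D.metric.normSq₃ x (trilinForm (D.metric.covDeriv₂ D.k x)) := rfl

/-- `|∇k|²_h ≥ 0` (the metric `h` of an initial data set is Riemannian, `normSq₃_nonneg`).
[folklore] -/
theorem normSqCovDerivK_nonneg (D : InitialDataSet I X) [D.metric.HasLeviCivita] (x : X) :
    0 ≤ D.normSqCovDerivK x :=
  D.metric.normSq₃_nonneg x D.isRiemannian_metric _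

/-- `|∇k|²_h (x) = 0` iff `(∇k)_x = 0` (`normSq₃_eq_zero_iff`, `h` being Riemannian). [folklore] -/
theorem normSqCovDerivK_eq_zero_iff (D : InitialDataSet I X) [D.metric.HasLeviCivita] (x : X) :
    D.normSqCovDerivK x = 0 ↔ D.metric.covDeriv₂ D.k x = 0 := by
  rw [normSqCovDerivK_def, D.metric.normSq₃_eq_zero_iff x D.isRiemannian_metric,
    trilinForm_eq_zero_iff]

/-- **Frame formula for `|∇k|²_h`**: in an `h_x`-orthogonal basis `e` of `T_x X` (non-null, as
`h` is Riemannian), `|∇k|²_h (x) = ∑ᵢ ∑ⱼ ∑ₗ (∇k)_x(eᵢ, eⱼ, eₗ)² / (h(eᵢ,eᵢ) h(eⱼ,eⱼ) h(eₗ,eₗ))`;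
for an `h_x`-orthonormal basis this is `∑ ((∇_{eₗ} k)(eᵢ, eⱼ))²`. O'Neill 1983, Ch. 3,
pp. 60–61. [folklore] -/
theorem normSqCovDerivK_eq_sum_sq (D : InitialDataSet I X) [D.metric.HasLeviCivita] (x : X)
    {ι : Type*} [Fintype ι] [DecidableEq ι] (e : Basis ι ℝ (TangentSpace I x))
    (he : (D.metric.toBilinForm x).IsOrthoᵢ e) :
    D.normSqCovDerivK x = ∑ i, ∑ j, ∑ l, D.metric.covDeriv₂ D.k x (e i) (e j) (e l) ^ 2 /
      (D.h.inner x (e i) (e i) * D.h.inner x (e j) (e j) * D.h.inner x (e l) (e l)) := by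
  have hc : ∀ i, D.metric.val x (e i) (e i) ≠ 0 :=
    fun i ↦ (D.isRiemannian_metric x (e i) (e.ne_zero i)).ne'
  rw [normSqCovDerivK_def, D.metric.normSq₃_eq_sum_sq x e he hc]
  simp

/-- For **time-symmetric** data (`k = 0`) `|∇k|²_h = 0` identically (`∇0 = 0`,
`PseudoRiemannianMetric.covDeriv₂_zero`). [folklore] -/
theorem IsTimeSymmetric.normSqCovDerivK_eq_zero {D : InitialDataSet I X} [D.metric.HasLeviCivita]
    (hD : D.IsTimeSymmetric) (x : X) : D.normSqCovDerivK x = 0 := by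
  have hk : D.k = fun _ ↦ 0 := funext hD
  rw [normSqCovDerivK_eq_zero_iff, hk, PseudoRiemannianMetric.covDeriv₂_zero]

end InitialDataSet

end Literature.Geometry.Lorentzian

end
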